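import Summits.AtomisticToContinuum.FouriersLaw.Theorems.BondHeatUncertaintySubdiffusiveBondHeatJunctionProfileSplit

/-!
# `JunctionDefectGrading` — file 5: OFF-DIAGONAL profile budgets (locality `c` + passivity `b`) ⟹ a BUFFERED JUNCTION LAW ⟹ `SplitLaw 0`,
# closing 11071 with ANY positive exponent floor `F(s)`, `0 < s ≤ 1`
# (cell `decomp-a2c`, lens-1 «grading / quantitative ladder», gen 57; beneath file 3's frame `SplitLaw θ ∧ ExponentFloor s ⟹ 11071`, `θ < s`)

File 4 split `BufferedSeriesLaw` (`r_u + r_v ≤ r_{u+L₀+v}`, `r = 1/E`) into two first-order PROFILE pieces sharing ONE constant: locality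
`EmbeddedBlockLawAt … c L₀` (in-situ block drop `≥ δ·E_N·(r_block − c)`) and the floor `BufferFloorAt … c L₀` (buffer drop `≥ δ·2c·E_N`), the
two budgets cancelling exactly (the DIAGONAL).  This file reads the same telescoping identity OFF the diagonal:
* `BufferPassivityAt … b L₀` — PASSIVITY WITH BACK-FLOW BUDGET `b`: to first order in `δ` the kinetic temperature does not RISE across the
  buffer by more than `b·E_N·δ` (`= b·j/γ` in current units: a LOCAL second-law statement «back-flow ≤ b × current»; `b = 0`: monotone
  first-order profile across the buffer; `b < 0` is file 4's floor of height `−b/2`, `bufferFloorAt_of_bufferPassivityAt`).  Holds at the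
  harmonic member (flat bulk) — the SOFT piece; [piece · passivity]
* locality keeps its own contact budget `c` (file 4's `EmbeddedBlockLawAt`, by name).
SEAM (PROVED, same bookkeeping as `series_of_profileAt`): the three first-order drops telescope to `δ`, so locality(`c`) + passivity(`b`) give
`r_u + r_v − (2c + b) ≤ r_{u+L₀+v}` (`bufferedJunction_of_profileAt`) — the series law with a CONSTANT defect over a FIXED buffer:
`BufferedJunctionLaw` (`∃ C ≥ 0, L₀, N₂: r_u + r_v − C ≤ r_{u+L₀+v}`, `u, v ≥ N₂`), which is `SplitLaw 0` (`splitLaw_zero_of_bufferedJunctionLaw`: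
cut `N − L₀` in half), hence with the TREE kernel at `θ = 0 < s`:
`boundedResponse_of_localityPassivityLaw_of_exponentFloor : 0 < s → s ≤ 1 → LocalityPassivityLaw → ExponentFloor s → BoundedResponse`.
GRADING CONTENT.  The defect currency decides the exponent: an ABSOLUTE contact budget gives `θ = 0` and pairs with ANY `s > 0` (census
`s_obs ≈ 0.61 / 0.75 / 0.875` at T = 1 / 3 / 10 — every observed floor suffices); the memo's relative «interface thermalisation `ε_L ≲ L^{−a}`»
bookkeeping `θ = 1 − aβ` needs `r_u ≤ C·u` to absorb the relative error, i.e. the OPEN aside `ConductanceFloor` (REP 24581) — typed and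
dominated in the companion file `…JunctionRelativeSplit` (floor-free multiplicative kernel).  `BufferedJunctionLaw` alone has no Fourier content
(`bufferedJunction_of_bounded`: bounded `r` satisfies its shape), so the floor `F(s)`, `s > 0`, is where resistance growth enters, and `s = 0`
is sharp (file 1 `threshold_sharp` at `θ = 0`).  Each of the three leaves — locality(`c`), passivity(`b`), `F(s)` — is satisfied by a
bounded-resistance (harmonic-like) chain or is strictly weaker than 11071; only jointly do they decide it.
No `sorry`; standard axioms; imports only file 4.
-/

noncomputable section

open MeasureTheory Set
open Literature.MathematicalPhysics.KineticTheory.HeatConduction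

namespace Summit.AtomisticToContinuum.FouriersLaw.Theorems.SubdiffusiveBondHeat

namespace JunctionDefectGrading

open Summit.AtomisticToContinuum.FouriersLaw.Theses.BondHeatUncertainty (BoundedResponse)
open Summit.AtomisticToContinuum.FouriersLaw.Theorems.SubdiffusiveBondHeat.EscapeGrading
  (escapeDeficit ExponentFloor ExponentBootstrap)

/-! ## A. Resistance level: the buffered junction law (constant defect over a fixed buffer) -/

/-- **Buffered junction law**: `∀ T > 0 ∃ C ≥ 0 ∃ L₀ N₂ ∀ u v ≥ N₂, 1/E_u + 1/E_v − C ≤ 1/E_{u+L₀+v}` — the series law of escape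
resistances across a sacrificed buffer of FIXED length, up to a CONSTANT defect.  Tags: WEAKER than `BufferedSeriesLaw` (`C = 0`,
`bufferedJunctionLaw_of_bufferedSeriesLaw`) and than `JunctionLaw 0` = 11748 (`L₀ = 0`, `bufferedJunctionLaw_of_junctionLaw_zero`); implies
`SplitLaw 0` (`splitLaw_zero_of_bufferedJunctionLaw`); no Fourier content alone (`bufferedJunction_of_bounded`); with `ExponentFloor s`, ANY
`0 < s ≤ 1`, it closes 11071 (`boundedResponse_of_bufferedJunctionLaw_of_exponentFloor`).  UNDECIDED · IDEA-NEEDED · INSTRUMENTABLE (census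
`C_L = r_u + r_v − r_{u+L+v}` bounded in `(u,v)` at fixed `L`: T = 10, L = 96: `C_96 ≈ −0.9` at (64,64); prediction: stays `≤ O(1)` at (128,128),
(256,256)). [piece · rung] -/
def BufferedJunctionLaw : Prop :=
  ∀ ω₂ lam β γ : ℝ, 0 < ω₂ → 0 < lam → 0 < β → 0 < γ → ∀ T : ℝ, 0 < T →
    ∃ C : ℝ, 0 ≤ C ∧ ∃ L₀ N₂ : ℕ, ∀ u v : ℕ, N₂ ≤ u → N₂ ≤ v →
      1 / escapeDeficit ω₂ lam β γ T u + 1 / escapeDeficit ω₂ lam β γ T v - C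
        ≤ 1 / escapeDeficit ω₂ lam β γ T (u + L₀ + v)

/-- `BufferedSeriesLaw ⟹ BufferedJunctionLaw` (defect `C = 0`). [folklore] -/
theorem bufferedJunctionLaw_of_bufferedSeriesLaw (hB : BufferedSeriesLaw) : BufferedJunctionLaw := by
  intro ω₂ lam β γ hω hl hβ hγ T hT
  obtain ⟨L₀, N₂, h⟩ := hB ω₂ lam β γ hω hl hβ hγ T hT
  exact ⟨0, le_rfl, L₀, N₂, fun u v hu hv => by have h' := h u v hu hv; linarith⟩

/-- `JunctionLaw 0` (= 11748 `SuperadditiveResistance`, file 2) `⟹ BufferedJunctionLaw` (empty buffer `L₀ = 0`). [folklore] -/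
theorem bufferedJunctionLaw_of_junctionLaw_zero (hJ : JunctionLaw 0) : BufferedJunctionLaw := by
  intro ω₂ lam β γ hω hl hβ hγ T hT
  obtain ⟨C, hC, h⟩ := hJ ω₂ lam β γ hω hl hβ hγ T hT
  refine ⟨C, hC, 0, 2, fun u v hu hv => ?_⟩
  have h' := h u v hu hv
  rw [Real.rpow_zero, mul_one] at h'
  have huv : u + 0 + v = u + v := by omega
  rw [huv]
  exact h'

/-- **`BufferedJunctionLaw ⟹ SplitLaw 0`**: cut `N − L₀` in half (parts `≥ N/3` once `N ≥ 3L₀ + 2N₂ + 4`); buffer `L₀ ≤ (C + L₀)·N⁰`, defect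
`C ≤ (C + L₀)·N⁰`. [this file] -/
theorem splitLaw_zero_of_bufferedJunctionLaw (hB : BufferedJunctionLaw) : SplitLaw 0 := by
  intro ω₂ lam β γ hω hl hβ hγ T hT
  obtain ⟨C, hC, L₀, N₂, h⟩ := hB ω₂ lam β γ hω hl hβ hγ T hT
  refine ⟨C + L₀, add_nonneg hC (Nat.cast_nonneg L₀), 0, zero_lt_one, 3 * L₀ + 2 * N₂ + 4, fun N hN => ?_⟩
  refine ⟨(N - L₀) / 2, N - L₀ - (N - L₀) / 2, by omega, by omega, by omega, ?_, ?_⟩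
  · have hsum : (N - L₀) / 2 + (N - L₀ - (N - L₀) / 2) + L₀ = N := by omega
    have hcast : (((N - L₀) / 2 : ℕ) : ℝ) + ((N - L₀ - (N - L₀) / 2 : ℕ) : ℝ) + (L₀ : ℝ) = (N : ℝ) := by exact_mod_cast hsum
    rw [Real.rpow_zero, mul_one]
    linarith
  · have hle := h ((N - L₀) / 2) (N - L₀ - (N - L₀) / 2) (by omega) (by omega)
    have hsum : (N - L₀) / 2 + L₀ + (N - L₀ - (N - L₀) / 2) = N := by omega
    rw [hsum] at hle
    rw [Real.rpow_zero, mul_one]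
    have h0 : (0 : ℝ) ≤ (L₀ : ℝ) := Nat.cast_nonneg L₀
    linarith

/-- **`BufferedJunctionLaw → ExponentFloor s → BoundedResponse`** for ANY `0 < s ≤ 1` (tree kernel at `θ = 0 < s`). [kernel · frame] -/
theorem boundedResponse_of_bufferedJunctionLaw_of_exponentFloor {s : ℝ} (hs0 : 0 < s) (hs : s ≤ 1) :
    BufferedJunctionLaw → ExponentFloor s → BoundedResponse := fun hB hF =>
  boundedResponse_of_splitLaw_of_exponentFloor hs0 hs0.le hs (splitLaw_zero_of_bufferedJunctionLaw hB) hF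

/-- `BufferedJunctionLaw ⟹ (F(s) ⟹ F(1))` for every `0 < s ≤ 1`: the whole open exponent ladder collapses under the buffered junction law.
[kernel · frame] -/
theorem exponentBootstrap_of_bufferedJunctionLaw {s : ℝ} (hs0 : 0 < s) (hs : s ≤ 1) (hB : BufferedJunctionLaw) :
    ExponentBootstrap s :=
  exponentBootstrap_of_splitLaw hs0 hs0.le hs (splitLaw_zero_of_bufferedJunctionLaw hB)

/-- Calibration: the buffered-junction SHAPE has no Fourier content alone — every bounded sequence satisfies it (defect `3·sup|r|`), so the
floor `F(s)`, `s > 0`, is load-bearing, and `s = 0` is sharp (file 1 `threshold_sharp`). [folklore] -/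
theorem bufferedJunction_of_bounded {r : ℕ → ℝ} {M : ℝ} (hM : ∀ N : ℕ, |r N| ≤ M) (L₀ u v : ℕ) :
    r u + r v - 3 * M ≤ r (u + L₀ + v) := by
  have hu := (abs_le.1 (hM u)).2
  have hv := (abs_le.1 (hM v)).2
  have hw := (abs_le.1 (hM (u + L₀ + v))).1
  linarith

/-! ## B. Profile level: passivity with a back-flow budget, and the off-diagonal seam -/

/-- **Buffer passivity with back-flow budget `b`** at `(ω₂, lam, β, γ, T)`, buffer `L₀`: `∃ N₂, ∀ u v ≥ N₂` (`u, v ≥ 1`), `∀ ε > 0`, for all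
small `δ > 0` and every steady state `μ` of the `(u + L₀ + v)`-chain at `(T + δ/2, T − δ/2)`:
`⟨p_{u−1}²⟩_μ − ⟨p_{u+L₀}²⟩_μ ≥ −δ·(b·E_N + ε)` — across the buffer the first-order kinetic temperature rises by at most `b·E_N·δ = b·j/γ`
(back-flow at most `b` contact units × the current).  `b = 0`: monotone first-order profile across the buffer; `b < 0`: a floor (file 4's
`BufferFloorAt … (−b/2) L₀`, `bufferFloorAt_of_bufferPassivityAt`).  Tags: UNDECIDED · IDEA-NEEDED (no sign information on NESS profiles of the
anharmonic pinned chain in tree or print) · INSTRUMENTABLE (sign of `φ(u+L₀) − φ(u−1)`); expected for EVERY member incl. the harmonic one (flat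
bulk) — the SOFT piece; presupposes second moments of steady states (the kinetic temperatures are Bochner integrals). [piece · passivity] -/
def BufferPassivityAt (ω₂ lam β γ T b : ℝ) (L₀ : ℕ) : Prop :=
  ∃ N₂ : ℕ, ∀ u v : ℕ, N₂ ≤ u → N₂ ≤ v → ∀ (_hu : 1 ≤ u) (_hv : 1 ≤ v), ∀ ε : ℝ, 0 < ε →
    ∃ δ₀ : ℝ, 0 < δ₀ ∧ ∀ δ : ℝ, 0 < δ → δ < δ₀ →
      ∀ μ : Measure (PhaseSpace (u + L₀ + v)),
        (pinnedChain ω₂ lam β γ).IsSteadyState (u + L₀ + v) (T + δ / 2) (T - δ / 2) μ →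
          -(δ * (b * escapeDeficit ω₂ lam β γ T (u + L₀ + v) + ε))
              ≤ ∫ x, x.2 ⟨u - 1, by omega⟩ ^ 2 ∂μ - ∫ x, x.2 ⟨u + L₀, by omega⟩ ^ 2 ∂μ

/-- **Locality + passivity law**: for all parameters and `T > 0` there are a contact budget `c`, a back-flow budget `b` and a buffer `L₀` with
`EmbeddedBlockLawAt … c L₀` (file 4, locality) and `BufferPassivityAt … b L₀`.  The off-diagonal reading of file 4's `ProfileSplitLaw`
(which is the case `b = −2c`, `localityPassivityLaw_of_profileSplitLaw`).  Implies `BufferedJunctionLaw` (defect `max (2c + b) 0`), hence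
`SplitLaw 0`, hence 11071 given ANY `ExponentFloor s`, `s > 0`. [piece · conjunction] -/
def LocalityPassivityLaw : Prop :=
  ∀ ω₂ lam β γ : ℝ, 0 < ω₂ → 0 < lam → 0 < β → 0 < γ → ∀ T : ℝ, 0 < T →
    ∃ c b : ℝ, ∃ L₀ : ℕ, EmbeddedBlockLawAt ω₂ lam β γ T c L₀ ∧ BufferPassivityAt ω₂ lam β γ T b L₀

/-- Dictionary: passivity with budget `b` IS file 4's buffer floor at height `−b/2` (same inequality). [folklore] -/
theorem bufferFloorAt_of_bufferPassivityAt {ω₂ lam β γ T b : ℝ} {L₀ : ℕ} (h : BufferPassivityAt ω₂ lam β γ T b L₀) :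
    BufferFloorAt ω₂ lam β γ T (-(b / 2)) L₀ := by
  obtain ⟨N₂, h⟩ := h
  refine ⟨N₂, fun u v hu hv hu1 hv1 ε hε => ?_⟩
  obtain ⟨δ₀, hδ₀, h⟩ := h u v hu hv hu1 hv1 ε hε
  refine ⟨δ₀, hδ₀, fun δ hδ hδδ₀ μ hμ => ?_⟩
  have hineq := h δ hδ hδδ₀ μ hμ
  have e : δ * (2 * (-(b / 2)) * escapeDeficit ω₂ lam β γ T (u + L₀ + v) - ε)
      = -(δ * (b * escapeDeficit ω₂ lam β γ T (u + L₀ + v) + ε)) := by ring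
  rw [e]
  exact hineq

/-- Dictionary, converse: file 4's buffer floor at height `c` is passivity with budget `−2c`. [folklore] -/
theorem bufferPassivityAt_of_bufferFloorAt {ω₂ lam β γ T c : ℝ} {L₀ : ℕ} (h : BufferFloorAt ω₂ lam β γ T c L₀) :
    BufferPassivityAt ω₂ lam β γ T (-(2 * c)) L₀ := by
  obtain ⟨N₂, h⟩ := h
  refine ⟨N₂, fun u v hu hv hu1 hv1 ε hε => ?_⟩
  obtain ⟨δ₀, hδ₀, h⟩ := h u v hu hv hu1 hv1 ε hε
  refine ⟨δ₀, hδ₀, fun δ hδ hδδ₀ μ hμ => ?_⟩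
  have hineq := h δ hδ hδδ₀ μ hμ
  have e : -(δ * (-(2 * c) * escapeDeficit ω₂ lam β γ T (u + L₀ + v) + ε))
      = δ * (2 * c * escapeDeficit ω₂ lam β γ T (u + L₀ + v) - ε) := by ring
  rw [e]
  exact hineq

/-- Passivity weakens monotonically in the budget: `b ≤ b' ⟹ passivity(b) ⟹ passivity(b')` (`E_N ≥ 0` for `N ≥ 2`). [folklore] -/
theorem bufferPassivityAt_mono {ω₂ lam β γ T b b' : ℝ} {L₀ : ℕ} (hω : 0 < ω₂) (hl : 0 < lam) (hβ : 0 < β) (hγ : 0 < γ)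
    (hT : 0 < T) (hbb' : b ≤ b') (h : BufferPassivityAt ω₂ lam β γ T b L₀) : BufferPassivityAt ω₂ lam β γ T b' L₀ := by
  obtain ⟨N₂, h⟩ := h
  refine ⟨max N₂ 2, fun u v hu hv hu1 hv1 ε hε => ?_⟩
  obtain ⟨δ₀, hδ₀, h⟩ := h u v (le_trans (le_max_left _ _) hu) (le_trans (le_max_left _ _) hv) hu1 hv1 ε hε
  refine ⟨δ₀, hδ₀, fun δ hδ hδδ₀ μ hμ => ?_⟩
  have hineq := h δ hδ hδδ₀ μ hμ
  have hEN : 0 < escapeDeficit ω₂ lam β γ T (u + L₀ + v) :=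
    escapeDeficit_pos hω hl hβ hγ hT (by have := le_trans (le_max_right N₂ 2) hu; omega)
  have hmono : -(δ * (b' * escapeDeficit ω₂ lam β γ T (u + L₀ + v) + ε))
      ≤ -(δ * (b * escapeDeficit ω₂ lam β γ T (u + L₀ + v) + ε)) := by
    apply neg_le_neg
    apply mul_le_mul_of_nonneg_left _ hδ.le
    nlinarith
  exact hmono.trans hineq

/-- **THE OFF-DIAGONAL SEAM: locality(`c`) + passivity(`b`) ⟹ the junction inequality with constant defect `2c + b` across the buffer**:
`∃ N₂, ∀ u v ≥ N₂, 1/E_u + 1/E_v − (2c + b) ≤ 1/E_{u+L₀+v}`.  Proof: at one small `δ > 0` and one steady state (which exists,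
`pinnedChain_exists_isSteadyState`) the three first-order inequalities add up — the interface temperatures cancel, the total drop is `δ` — to
`δ·(E_N·(1/E_u + 1/E_v − 2c − b) − 3ε) ≤ δ`; let `ε → 0`, divide by `E_N > 0`. [this file] -/
theorem bufferedJunction_of_profileAt {ω₂ lam β γ T c b : ℝ} {L₀ : ℕ} (hω : 0 < ω₂) (hl : 0 < lam) (hβ : 0 < β) (hγ : 0 < γ)
    (hT : 0 < T) (hE : EmbeddedBlockLawAt ω₂ lam β γ T c L₀) (hP : BufferPassivityAt ω₂ lam β γ T b L₀) :
    ∃ N₂ : ℕ, ∀ u v : ℕ, N₂ ≤ u → N₂ ≤ v →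
      1 / escapeDeficit ω₂ lam β γ T u + 1 / escapeDeficit ω₂ lam β γ T v - (2 * c + b)
        ≤ 1 / escapeDeficit ω₂ lam β γ T (u + L₀ + v) := by
  obtain ⟨N₂, hE⟩ := hE
  obtain ⟨N₂', hP⟩ := hP
  refine ⟨max (max N₂ N₂') 2, fun u v hu hv => ?_⟩
  have hu2 : 2 ≤ u := le_trans (le_max_right _ _) hu
  have huN : N₂ ≤ u := le_trans (le_trans (le_max_left _ _) (le_max_left _ _)) hu
  have hvN : N₂ ≤ v := le_trans (le_trans (le_max_left _ _) (le_max_left _ _)) hv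
  have huN' : N₂' ≤ u := le_trans (le_trans (le_max_right _ _) (le_max_left _ _)) hu
  have hvN' : N₂' ≤ v := le_trans (le_trans (le_max_right _ _) (le_max_left _ _)) hv
  have hv2 : 2 ≤ v := le_trans (le_max_right _ _) hv
  set EN := escapeDeficit ω₂ lam β γ T (u + L₀ + v) with hEN_def
  set Eu := escapeDeficit ω₂ lam β γ T u with hEu_def
  set Ev := escapeDeficit ω₂ lam β γ T v with hEv_def
  have hENpos : 0 < EN := escapeDeficit_pos hω hl hβ hγ hT (by omega)
  -- the key inequality `E_N · (1/E_u + 1/E_v − 2c − b) ≤ 1`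
  have key : EN * (1 / Eu + 1 / Ev - (2 * c + b)) ≤ 1 := by
    refine le_of_forall_pos_le_add fun ε hε => ?_
    have hε3 : 0 < ε / 3 := by positivity
    obtain ⟨δ₁, hδ₁, h1⟩ := hE u v huN hvN (by omega) (by omega) (ε / 3) hε3
    obtain ⟨δ₂, hδ₂, h2⟩ := hP u v huN' hvN' (by omega) (by omega) (ε / 3) hε3
    set δ : ℝ := min (min δ₁ δ₂) T / 2 with hδ_def
    have hm1 : min (min δ₁ δ₂) T ≤ δ₁ := (min_le_left _ _).trans (min_le_left _ _)
    have hm2 : min (min δ₁ δ₂) T ≤ δ₂ := (min_le_left _ _).trans (min_le_right _ _)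
    have hmT : min (min δ₁ δ₂) T ≤ T := min_le_right _ _
    have hmpos : 0 < min (min δ₁ δ₂) T := lt_min (lt_min hδ₁ hδ₂) hT
    have hδpos : 0 < δ := by rw [hδ_def]; linarith
    have hδlt1 : δ < δ₁ := by rw [hδ_def]; linarith
    have hδlt2 : δ < δ₂ := by rw [hδ_def]; linarith
    have hTL : 0 < T + δ / 2 := by linarith
    have hTR : 0 < T - δ / 2 := by rw [hδ_def]; linarith
    obtain ⟨μ, hμ⟩ := pinnedChain_exists_isSteadyState hω hl hβ hγ (u + L₀ + v) hTL hTR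
    obtain ⟨hleft, hright⟩ := h1 δ hδpos hδlt1 μ hμ
    have hmid := h2 δ hδpos hδlt2 μ hμ
    -- add the three drops: the interface temperatures cancel, the total is `δ`
    have hsum : δ * (EN * (1 / Eu + 1 / Ev - (2 * c + b)) - ε) ≤ δ := by
      have hadd := add_le_add (add_le_add hleft hmid) hright
      have hlhs : δ * (EN * (1 / Eu - c) - ε / 3) + -(δ * (b * EN + ε / 3)) + δ * (EN * (1 / Ev - c) - ε / 3)
          = δ * (EN * (1 / Eu + 1 / Ev - (2 * c + b)) - ε) := by ring
      have hrhs : (T + δ / 2 - ∫ x, x.2 ⟨u - 1, by omega⟩ ^ 2 ∂μ)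
          + (∫ x, x.2 ⟨u - 1, by omega⟩ ^ 2 ∂μ - ∫ x, x.2 ⟨u + L₀, by omega⟩ ^ 2 ∂μ)
          + (∫ x, x.2 ⟨u + L₀, by omega⟩ ^ 2 ∂μ - (T - δ / 2)) = δ := by ring
      linarith
    have hdiv : EN * (1 / Eu + 1 / Ev - (2 * c + b)) - ε ≤ 1 := by
      by_contra hcon
      push Not at hcon
      have : δ * 1 < δ * (EN * (1 / Eu + 1 / Ev - (2 * c + b)) - ε) := mul_lt_mul_of_pos_left hcon hδpos
      linarith
    linarith
  -- divide by `E_N > 0` (no sign condition on the left-hand side is needed)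
  rw [le_div_iff₀ hENpos]
  calc (1 / Eu + 1 / Ev - (2 * c + b)) * EN = EN * (1 / Eu + 1 / Ev - (2 * c + b)) := by ring
    _ ≤ 1 := key

/-- **`LocalityPassivityLaw ⟹ BufferedJunctionLaw`** (defect `max (2c + b) 0 ≥ 0`). [this file] -/
theorem bufferedJunctionLaw_of_localityPassivityLaw (h : LocalityPassivityLaw) : BufferedJunctionLaw := by
  intro ω₂ lam β γ hω hl hβ hγ T hT
  obtain ⟨c, b, L₀, hE, hP⟩ := h ω₂ lam β γ hω hl hβ hγ T hT
  obtain ⟨N₂, hN⟩ := bufferedJunction_of_profileAt hω hl hβ hγ hT hE hP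
  refine ⟨max (2 * c + b) 0, le_max_right _ _, L₀, N₂, fun u v hu hv => ?_⟩
  have hle := hN u v hu hv
  have hmax : 2 * c + b ≤ max (2 * c + b) 0 := le_max_left _ _
  linarith

/-- `ProfileSplitLaw ⟹ LocalityPassivityLaw` (the diagonal `b = −2c`). [folklore] -/
theorem localityPassivityLaw_of_profileSplitLaw (h : ProfileSplitLaw) : LocalityPassivityLaw := by
  intro ω₂ lam β γ hω hl hβ hγ T hT
  obtain ⟨c, L₀, hE, hB⟩ := h ω₂ lam β γ hω hl hβ hγ T hT
  exact ⟨c, -(2 * c), L₀, hE, bufferPassivityAt_of_bufferFloorAt hB⟩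

/-- **The seam asked for (critic row 728 (1)): locality + passivity ⟹ `SplitLaw 0`** — the defect exponent of the profile mechanism is `θ = 0`
(an absolute contact budget), not `1 − aβ`. [this file] -/
theorem splitLaw_zero_of_locality_of_passivity (h : LocalityPassivityLaw) : SplitLaw 0 :=
  splitLaw_zero_of_bufferedJunctionLaw (bufferedJunctionLaw_of_localityPassivityLaw h)

/-- **THE NODE: `LocalityPassivityLaw → ExponentFloor s → BoundedResponse` (11071 BY NAME) for ANY `0 < s ≤ 1`.** [kernel · frame] -/
theorem boundedResponse_of_localityPassivityLaw_of_exponentFloor {s : ℝ} (hs0 : 0 < s) (hs : s ≤ 1) :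
    LocalityPassivityLaw → ExponentFloor s → BoundedResponse := fun h hF =>
  boundedResponse_of_bufferedJunctionLaw_of_exponentFloor hs0 hs (bufferedJunctionLaw_of_localityPassivityLaw h) hF

/-- Registered instance `(θ, s) = (0, 1/2)`: locality + passivity + the half-Ohmic floor `E_N ≤ C/√N` decide 11071 (the census floor
`s_obs ≥ 0.61` at every probed temperature sits above `1/2`). [kernel · frame · instance] -/
theorem boundedResponse_of_localityPassivityLaw_of_halfOhmicFloor :
    LocalityPassivityLaw → ExponentFloor (1 / 2 : ℝ) → BoundedResponse :=
  boundedResponse_of_localityPassivityLaw_of_exponentFloor (by norm_num) (by norm_num)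

/-- `LocalityPassivityLaw ⟹ (F(s) ⟹ F(1))`, every `0 < s ≤ 1`. [kernel · frame] -/
theorem exponentBootstrap_of_localityPassivityLaw {s : ℝ} (hs0 : 0 < s) (hs : s ≤ 1) (h : LocalityPassivityLaw) :
    ExponentBootstrap s :=
  exponentBootstrap_of_bufferedJunctionLaw hs0 hs (bufferedJunctionLaw_of_localityPassivityLaw h)

end JunctionDefectGrading

end Summit.AtomisticToContinuum.FouriersLaw.Theorems.SubdiffusiveBondHeat

end
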